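import Summits.NavierStokesRegularity.FluidComputer.FamilySymmetry
import Literature.Analysis.FluidPDE.FluidComputer.ShellTransferParseval
import Mathlib.Data.Real.Pointwise
import HarnessLib

/-!
# Fluid computer — the REYNOLDS LADDER dictionary, typed (rung R3 pass 2, RULING R40; pub-fluidc-lit gen 39)

HONEST FRAMING (cell `pub-fluidc`, verbatim): *low prior, high value-of-information experiment on Tao's
machine paradigm; NOT a claim that NS blows up.*  Theorem side of the cell; nothing here is evidence of
blow-up and nothing beyond the truncated (Galerkin) Navier–Stokes system both DNS engines step is used.

RULING R40 (cell STATUS 2026-08-23 l.4140) reads ONE fixed field `u₀` along a ladder of viscosities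
`ν = ν₀/ρ` ("rung `ρ`") and records that the `×2`-energy sibling of the field at `ν₀` IS the `ρ = √2`
rung "by exact NS scaling (`u₀ ↦ √2·u₀` at fixed `ν` ≡ `u₀` at `ν/√2` with `t ↦ √2·t`)".  The scaling is
already a theorem of the tree for the Galerkin system: `FamilySymmetry.eq_scaleTime_visc` — if `û` is the
unforced run with viscosity `ν` and `V` the unforced run with viscosity `r ν` from `r·û(0)`, both supported
in the mode set `S`, then `V(t) = r·û(r t)` for all `t` — with `FamilySymmetry.truncEnstrophy_scaleTime_visc`
(every truncated energy and enstrophy of `V(t)` is `r²` times that of `û(r t)`).  This leaf adds the two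
lines the ladder's OBSERVABLES need and the pure-real bookkeeping the atlas words use:

* `field_scale`, `norm_field_scale` — the band-limited physical field `u_{B,j}(x) = Σ_{k∈B} û_j(k)e^{ik·x}`
  (tree: `ShellTransfer.field`) is linear in the amplitude, so `|u_{B,j}[r·û](x)| = |r|·|u_{B,j}[û](x)|`;
* `norm_field_ladder` — hence along the ladder `|u_{B,j}[V(t)](x)| = |r|·|u_{B,j}[û(r t)](x)|` for EVERY
  band `B` and every point: every band sup amplitude of the amplitude-`r` run at time `t` is `|r|` times
  that of the rung at time `r t` (bands need not lie in `S`);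
* the dictionary for observables `f_V(t) = a·f_U(r t)` (`a = |r|` for amplitudes, `a = r²` for energies /
  enstrophies; `a, r > 0`): `ratio_ladder` (ratios of two such observables at equal times agree with the
  rung's at time `r t` — `g`, `r = g/λ`, `Π`, `r₂`, `R = U₂/U₁`, `G₂/G₁`), `gain_ladder` (gains over the
  initial value agree — `G = u_max(t)/u_max(0)`, `η = E_out(t)/E_in(0)`), `isMaxOn_ladder_iff` (peak CLOCKS
  divide by `r`: `f_U` peaks on `[0,T]` at `s` iff `f_V` peaks on `[0,T/r]` at `s/r` — R40's check
  "AX `t_pk` 1.41–1.43 = 2.0/√2"), `image_ladder` / `sSup_ladder` (window suprema carry the factor `a`: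
  `sup_{[0,T/r]} f_V = a · sup_{[0,T]} f_U`, so `R_max` over matched windows is invariant).

Reading for the ladder (information, not a hypothesis of any lemma): rung `ρ` of R40 is `û` = the run of
`u₀` at `ν₀/ρ`; the amplitude-`ρ` run `V` from `ρ·u₀` at `ν₀` is `t ↦ ρ·û(ρ t)`; `ρ = √2` is p1's AX leg
(energy `×2`).  All dimensionless ladder words (g, r, G, Π, r_phys, r₂, R_max, η, Dc) are therefore
properties of the rung alone, and clocks quoted from an amplitude-scaled run are to be multiplied by `ρ`.
References: U. Frisch, *Turbulence* (CUP 1995) §2.2 pp. 17–18 (similarity principle; the cell file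
LITERATURE.md §A22.21a records the verbatim text and why the fixed-box form is the similarity principle
rather than one of the listed space-dilating scalings).  0 sorry, no new definitions, no named facts (D-0026).
-/

noncomputable section

namespace Summit.NavierStokesRegularity.FluidComputer.ReynoldsLadder

open Literature.Analysis.FluidPDE.FluidComputer
open Literature.Analysis.FluidPDE.FluidComputer.ShellTransfer
open Literature.Analysis.FluidPDE.FluidComputer.ShellTransfer.TaylorGreenHat
open Summit.NavierStokesRegularity.FluidComputer.FamilySymmetry
open Complex
open scoped BigOperators Pointwise

/-! ## §1 The band-limited physical field is linear in the amplitude -/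

/-- `u_{B,j}[r·û](x) = r · u_{B,j}[û](x)` for every band `B`. -/
theorem field_scale (r : ℝ) (A : FourierVelocity) (B : Finset (Fin 3 → ℤ)) (j : Fin 3) (x y z : ℝ) :
    field (scale r A) B j x y z = (r : ℂ) * field A B j x y z := by
  unfold field
  rw [Finset.mul_sum]
  refine Finset.sum_congr rfl fun k _ => ?_
  rw [scale_coeff, mul_assoc]

/-- `|u_{B,j}[r·û](x)| = |r| · |u_{B,j}[û](x)|`. -/
theorem norm_field_scale (r : ℝ) (A : FourierVelocity) (B : Finset (Fin 3 → ℤ)) (j : Fin 3)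
    (x y z : ℝ) : ‖field (scale r A) B j x y z‖ = |r| * ‖field A B j x y z‖ := by
  rw [field_scale, norm_mul, Complex.norm_real, Real.norm_eq_abs]

/-! ## §2 The ladder identity for band amplitudes (energies/enstrophies: `truncEnstrophy_scaleTime_visc`) -/

variable {U V : ℝ → FourierVelocity} {S : Finset (Fin 3 → ℤ)} {c c' : ℝ → (Fin 3 → ℤ) → ℂ} {ν r : ℝ}

/-- **Band amplitudes along the Reynolds ladder.**  `û` = the rung (unforced Galerkin run, viscosity `ν`),
`V` = the unforced run with viscosity `r ν` from `r·û(0)`, both supported in `S`: for every band `B`, every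
component and every point, `|u_{B,j}[V(t)](x)| = |r| · |u_{B,j}[û(r t)](x)|`. -/
theorem norm_field_ladder (hU : IsGalerkinSolution U S ν c fun _ _ _ => 0) (hs : IsSupportedOn U S)
    (hV : IsGalerkinSolution V S (r * ν) c' fun _ _ _ => 0) (hsV : IsSupportedOn V S)
    (h0 : V 0 = scale r (U 0)) (B : Finset (Fin 3 → ℤ)) (j : Fin 3) (x y z t : ℝ) :
    ‖field (V t) B j x y z‖ = |r| * ‖field (U (r * t)) B j x y z‖ := by
  rw [eq_scaleTime_visc hU hs hV hsV h0 t, norm_field_scale]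

/-- The same for the coefficients themselves: `V̂_j(k, t) = r · û_j(k, r t)`. -/
theorem coeff_ladder (hU : IsGalerkinSolution U S ν c fun _ _ _ => 0) (hs : IsSupportedOn U S)
    (hV : IsGalerkinSolution V S (r * ν) c' fun _ _ _ => 0) (hsV : IsSupportedOn V S)
    (h0 : V 0 = scale r (U 0)) (k : Fin 3 → ℤ) (j : Fin 3) (t : ℝ) :
    (V t).coeff k j = (r : ℂ) * (U (r * t)).coeff k j := by
  rw [eq_scaleTime_visc hU hs hV hsV h0 t, scale_coeff]

/-! ## §3 The dictionary for observables `f_V(t) = a · f_U(r t)` -/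

section Observables

variable {fU fV gU gV : ℝ → ℝ} {a r : ℝ}

/-- RATIOS at equal times are the rung's ratios at time `r t` (`g`, `r = g/λ`, `Π`, `r₂`, `R = U₂/U₁`,
`G₂/G₁`): if `f_V = a·f_U(r·)` and `g_V = a·g_U(r·)` with `a ≠ 0` then `g_V(t)/f_V(t) = g_U(rt)/f_U(rt)`. -/
theorem ratio_ladder (ha : a ≠ 0) (hf : ∀ t, fV t = a * fU (r * t)) (hg : ∀ t, gV t = a * gU (r * t))
    (t : ℝ) : gV t / fV t = gU (r * t) / fU (r * t) := by
  rw [hf, hg, mul_div_mul_left _ _ ha]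

/-- GAINS over the initial value agree (`G = u_max(t)/u_max(0)`, `η = E_out(t)/E_in(0)` with `a = r²`):
`f_V(t)/g_V(0) = f_U(r t)/g_U(0)`. -/
theorem gain_ladder (ha : a ≠ 0) (hf : ∀ t, fV t = a * fU (r * t)) (hg : ∀ t, gV t = a * gU (r * t))
    (t : ℝ) : fV t / gV 0 = fU (r * t) / gU 0 := by
  rw [hf, hg, mul_zero, mul_div_mul_left _ _ ha]

/-- The time dilation maps the rung's window `[0, T]` onto the scaled run's window `[0, T/r]`. -/
theorem mem_Icc_div_iff (hr : 0 < r) {T t : ℝ} : t ∈ Set.Icc 0 (T / r) ↔ r * t ∈ Set.Icc 0 T := by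
  simp only [Set.mem_Icc]
  constructor
  · rintro ⟨h0, h1⟩
    exact ⟨mul_nonneg hr.le h0, by rwa [le_div_iff₀' hr] at h1⟩
  · rintro ⟨h0, h1⟩
    exact ⟨le_of_mul_le_mul_left (by simpa using h0) hr, by rwa [le_div_iff₀' hr]⟩

/-- PEAK CLOCKS divide by `r`: with `a > 0`, `r > 0`, `f_U` attains its maximum over `[0, T]` at `s`
iff `f_V` attains its maximum over `[0, T/r]` at `s/r` (R40: the AX leg's `t_pk ≈ 2.0/√2`). -/
theorem isMaxOn_ladder_iff (ha : 0 < a) (hr : 0 < r) (hf : ∀ t, fV t = a * fU (r * t)) {T s : ℝ} :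
    IsMaxOn fU (Set.Icc 0 T) s ↔ IsMaxOn fV (Set.Icc 0 (T / r)) (s / r) := by
  have hrs : r * (s / r) = s := mul_div_cancel₀ s hr.ne'
  constructor
  · intro h t ht
    show fV t ≤ fV (s / r)
    rw [hf, hf, hrs]
    exact mul_le_mul_of_nonneg_left (h ((mem_Icc_div_iff hr).1 ht)) ha.le
  · intro h t ht
    show fU t ≤ fU s
    have ht' : t / r ∈ Set.Icc 0 (T / r) := by
      rw [mem_Icc_div_iff hr, mul_div_cancel₀ t hr.ne']
      exact ht
    have key : fV (t / r) ≤ fV (s / r) := h ht'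
    rw [hf, hf, hrs, mul_div_cancel₀ t hr.ne'] at key
    exact le_of_mul_le_mul_left key ha

/-- The scaled run's values on `[0, T/r]` are `a` times the rung's values on `[0, T]`. -/
theorem image_ladder (hr : 0 < r) (hf : ∀ t, fV t = a * fU (r * t)) (T : ℝ) :
    fV '' Set.Icc 0 (T / r) = a • (fU '' Set.Icc 0 T) := by
  ext y
  simp only [Set.mem_image, Set.mem_smul_set, smul_eq_mul]
  constructor
  · rintro ⟨t, ht, rfl⟩
    exact ⟨fU (r * t), ⟨r * t, (mem_Icc_div_iff hr).1 ht, rfl⟩, (hf t).symm⟩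
  · rintro ⟨_, ⟨s, hs, rfl⟩, rfl⟩
    refine ⟨s / r, ?_, ?_⟩
    · rw [mem_Icc_div_iff hr, mul_div_cancel₀ s hr.ne']
      exact hs
    · rw [hf, mul_div_cancel₀ s hr.ne']

/-- WINDOW SUPREMA carry the factor `a` (`a ≥ 0`): `sup_{[0,T/r]} f_V = a · sup_{[0,T]} f_U`; hence a ratio
of two window suprema read on matched windows (`R_max`) is the rung's. -/
theorem sSup_ladder (ha : 0 ≤ a) (hr : 0 < r) (hf : ∀ t, fV t = a * fU (r * t)) (T : ℝ) :
    sSup (fV '' Set.Icc 0 (T / r)) = a * sSup (fU '' Set.Icc 0 T) := by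
  rw [image_ladder hr hf T, Real.sSup_smul_of_nonneg ha, smul_eq_mul]

/-- `R_max` INVARIANCE: the ratio of the window suprema of two ladder observables is the rung's. -/
theorem sSup_ratio_ladder (ha : 0 < a) (hr : 0 < r) (hf : ∀ t, fV t = a * fU (r * t))
    (hg : ∀ t, gV t = a * gU (r * t)) (T : ℝ) :
    sSup (gV '' Set.Icc 0 (T / r)) / sSup (fV '' Set.Icc 0 (T / r))
      = sSup (gU '' Set.Icc 0 T) / sSup (fU '' Set.Icc 0 T) := by
  rw [sSup_ladder ha.le hr hf, sSup_ladder ha.le hr hg, mul_div_mul_left _ _ ha.ne']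

end Observables

/-! ## §4 The band sup amplitude of a Galerkin run is a ladder observable with `a = |r|` -/

/-- For a fixed band `B`, component `j` and point `x`, the pointwise amplitude `t ↦ |u_{B,j}[·(t)](x)|` of
the scaled run is a ladder observable of the rung's with factor `|r|` — the hypothesis `hf` of §3. -/
theorem norm_field_isLadderObservable (hU : IsGalerkinSolution U S ν c fun _ _ _ => 0)
    (hs : IsSupportedOn U S) (hV : IsGalerkinSolution V S (r * ν) c' fun _ _ _ => 0)
    (hsV : IsSupportedOn V S) (h0 : V 0 = scale r (U 0)) (B : Finset (Fin 3 → ℤ)) (j : Fin 3)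
    (x y z : ℝ) :
    ∀ t, (fun t => ‖field (V t) B j x y z‖) t = |r| * (fun t => ‖field (U t) B j x y z‖) (r * t) :=
  fun t => norm_field_ladder hU hs hV hsV h0 B j x y z t

/-- … and so is the band SUP amplitude `U_B(t) = sup_{j,x} |u_{B,j}(x,t)|` (atlas key `band_umax`), written
as a supremum over the index set `Fin 3 × ℝ³`: `U_B[V](t) = |r| · U_B[û](r t)`. -/
theorem bandSup_ladder (hU : IsGalerkinSolution U S ν c fun _ _ _ => 0) (hs : IsSupportedOn U S)
    (hV : IsGalerkinSolution V S (r * ν) c' fun _ _ _ => 0) (hsV : IsSupportedOn V S)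
    (h0 : V 0 = scale r (U 0)) (B : Finset (Fin 3 → ℤ)) (t : ℝ) :
    (⨆ p : Fin 3 × ℝ × ℝ × ℝ, ‖field (V t) B p.1 p.2.1 p.2.2.1 p.2.2.2‖)
      = |r| * ⨆ p : Fin 3 × ℝ × ℝ × ℝ, ‖field (U (r * t)) B p.1 p.2.1 p.2.2.1 p.2.2.2‖ := by
  rw [Real.mul_iSup_of_nonneg (abs_nonneg r)]
  exact iSup_congr fun p => norm_field_ladder hU hs hV hsV h0 B p.1 p.2.1 p.2.2.1 p.2.2.2 t

end Summit.NavierStokesRegularity.FluidComputer.ReynoldsLadder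

end
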